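import Mathlib

/-!
# Crux `RankDefectRepresentations` (stmt-PneNP-18923), line `rank-dehn-ladder`: the COMMUTANT CRITERION
# (a non-certificate lower bound for the rank distance to genuine representations; lead g8)

Every distance lower bound on this line so far is a CERTIFICATE bound (`rank u(M) ≤ |u| · dist` for a cube-vanishing
formula `u`, or `rank [Σ E, Σ E′]`-type Lipschitz bounds), and such bounds are `≤ n · t / 8` for `t`-almost-representations
(NOTES of lead g8) — they can never reach the superlinear rung.  This file lands a lower bound of a different kind:
the COMMUTANT `Comm(E) = {X : X E_i = E_i X ∀ i}` is a rank-Lipschitz invariant,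

  `finrank Comm(E') ≤ finrank Comm(E) + 2 d · Σ_i rank (E_i − E'_i)`      (`finrank_commutant_le_add`),

while a genuine tuple in diagonal form (a colouring `c : [d] → {0,1}^n` of a common eigenbasis, the vocabulary of
`ExtensionStep` / the cut lemma) has a commutant of dimension `Σ_σ d_σ² ≥ d² / 2^n` (`sq_le_card_mul_finrank_commutant_diag`).
Hence the CRITERION (`commutant_criterion`): if `rank (E_i − diag_i c) ≤ r` for all `i` then

  `d² ≤ 2^n · (finrank Comm(E) + 2 n d r)`,

i.e. `dist ≥ (d² / 2^n − finrank Comm(E)) / (2 n d)`: an almost-representation of dimension `d ≫ 2^n` with a SMALL commutant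
(e.g. the linear span of a transitive `W_n`-set of size `≥ 2^{n+1}`, or an irreducible module of dimension `≫ 2^n`) is far from
every diagonal genuine tuple, with no certificate formula involved.  (Every commuting idempotent tuple is conjugate to a
diagonal one and both sides are conjugation invariant; that reduction is not needed by the consumers and is not formalised here.)
Consequence recorded in `Lines/rank-dehn-ladder-g8.md`: rung 1 / rung 2 follow from IRREDUCIBLE almost-representations of dimension
`≫ 2^n n² t` / `2^n n^{ω(1)} t`, equivalently (Clifford) from "knotted" low-curvature local systems on the cube graph.
HONEST FRAMING: elementary linear algebra; P ≠ NP is not moved; F-N2 is a FRONTIER formal rung.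
-/

set_option linter.dupNamespace false -- `Summit.PneNP.PneNP.…`: summit = sub-problem name (D-0017)

namespace Summit.PneNP.PneNP.Theorems.CnfIdealGenLengthRankDefectRepresentationsCommutantCriterion

open Matrix Module

variable {K : Type} [Field K] {d n : ℕ}

/-- The commutant of a tuple of square matrices, as a subspace of the matrix algebra. -/
def commutant (E : Fin n → Matrix (Fin d) (Fin d) K) : Submodule K (Matrix (Fin d) (Fin d) K) :=
  ⨅ i, LinearMap.ker (LinearMap.mulRight K (E i) - LinearMap.mulLeft K (E i))

/-- Membership in the commutant: `X` commutes with every `E_i`. -/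
theorem mem_commutant {E : Fin n → Matrix (Fin d) (Fin d) K} {X : Matrix (Fin d) (Fin d) K} :
    X ∈ commutant E ↔ ∀ i, X * E i = E i * X := by
  simp [commutant, Submodule.mem_iInf, LinearMap.mem_ker, sub_eq_zero]

/-! ## Kernels of one-sided multiplication have dimension `d · (d − rank)` -/

section OneSided

variable (Δ : Matrix (Fin d) (Fin d) K)

/-- `{X : X Δ = 0}`. -/
def kerR : Submodule K (Matrix (Fin d) (Fin d) K) := LinearMap.ker (LinearMap.mulRight K Δ)

/-- `{X : Δ X = 0}`. -/
def kerL : Submodule K (Matrix (Fin d) (Fin d) K) := LinearMap.ker (LinearMap.mulLeft K Δ)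

/-- Membership in `kerR`. -/
theorem mem_kerR {X : Matrix (Fin d) (Fin d) K} : X ∈ kerR Δ ↔ X * Δ = 0 := by
  simp [kerR, LinearMap.mem_ker]

/-- Membership in `kerL`. -/
theorem mem_kerL {X : Matrix (Fin d) (Fin d) K} : X ∈ kerL Δ ↔ Δ * X = 0 := by
  simp [kerL, LinearMap.mem_ker]

/-- `{X : X Δ = 0}` ≅ `(ker Δᵀ)^d` (row by row). -/
def kerREquiv : kerR Δ ≃ₗ[K] (Fin d → LinearMap.ker (Δᵀ).mulVecLin) where
  toFun X := fun a => ⟨fun b => X.1 a b, by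
    have h := (mem_kerR Δ).mp X.2
    rw [LinearMap.mem_ker, Matrix.mulVecLin_apply, Matrix.mulVec_transpose]
    ext b
    have := congrFun (congrFun h a) b
    simpa [Matrix.mul_apply, Matrix.vecMul, dotProduct] using this⟩
  invFun f := ⟨Matrix.of fun a b => (f a).1 b, by
    rw [mem_kerR]
    ext a b
    have h := (f a).2
    rw [LinearMap.mem_ker, Matrix.mulVecLin_apply, Matrix.mulVec_transpose] at h
    have := congrFun h b
    simpa [Matrix.mul_apply, Matrix.vecMul, dotProduct] using this⟩
  map_add' X Y := by ext a b; rfl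
  map_smul' c X := by ext a b; rfl
  left_inv X := by ext a b; rfl
  right_inv f := by ext a b; rfl

/-- `{X : Δ X = 0}` ≅ `(ker Δ)^d` (column by column). -/
def kerLEquiv : kerL Δ ≃ₗ[K] (Fin d → LinearMap.ker Δ.mulVecLin) where
  toFun X := fun b => ⟨fun a => X.1 a b, by
    have h := (mem_kerL Δ).mp X.2
    rw [LinearMap.mem_ker, Matrix.mulVecLin_apply]
    ext a
    have := congrFun (congrFun h a) b
    simpa [Matrix.mul_apply, Matrix.mulVec, dotProduct] using this⟩
  invFun f := ⟨Matrix.of fun a b => (f b).1 a, by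
    rw [mem_kerL]
    ext a b
    have h := (f b).2
    rw [LinearMap.mem_ker, Matrix.mulVecLin_apply] at h
    have := congrFun h a
    simpa [Matrix.mul_apply, Matrix.mulVec, dotProduct] using this⟩
  map_add' X Y := by ext a b; rfl
  map_smul' c X := by ext a b; rfl
  left_inv X := by ext a b; rfl
  right_inv f := by ext a b; rfl

/-- `dim {X : X Δ = 0} + d · rank Δ = d²`. -/
theorem finrank_kerR_add : finrank K (kerR Δ) + d * Δ.rank = d * d := by
  rw [(kerREquiv Δ).finrank_eq, Module.finrank_pi_fintype, Finset.sum_const, Finset.card_univ,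
    Fintype.card_fin, smul_eq_mul, ← Matrix.rank_transpose Δ, Matrix.rank, ← mul_add, add_comm,
    LinearMap.finrank_range_add_finrank_ker, Module.finrank_pi, Fintype.card_fin]

/-- `dim {X : Δ X = 0} + d · rank Δ = d²`. -/
theorem finrank_kerL_add : finrank K (kerL Δ) + d * Δ.rank = d * d := by
  rw [(kerLEquiv Δ).finrank_eq, Module.finrank_pi_fintype, Finset.sum_const, Finset.card_univ,
    Fintype.card_fin, smul_eq_mul, Matrix.rank, ← mul_add, add_comm,
    LinearMap.finrank_range_add_finrank_ker, Module.finrank_pi, Fintype.card_fin]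

end OneSided

/-! ## The commutant is rank-Lipschitz -/

/-- `dim (d × d matrices) = d²`. -/
theorem finrank_matrix_fin : finrank K (Matrix (Fin d) (Fin d) K) = d * d := by
  rw [Module.finrank_matrix]; simp

/-- `dim (A ⊓ B) + d² ≥ dim A + dim B` for subspaces of `d × d` matrices. -/
theorem finrank_add_le_finrank_inf_add (A B : Submodule K (Matrix (Fin d) (Fin d) K)) :
    finrank K A + finrank K B ≤ finrank K ↥(A ⊓ B) + d * d := by
  rw [← Submodule.finrank_sup_add_finrank_inf_eq A B, add_comm, ← finrank_matrix_fin (K := K) (d := d)]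
  exact Nat.add_le_add_left (Submodule.finrank_le _) _

/-- **Lipschitz bound.**  `dim Comm(E') ≤ dim Comm(E) + 2 d · Σ_i rank (E_i − E'_i)`: a matrix commuting with every
`E'_i` whose products with every difference `E_i − E'_i` vanish on both sides commutes with every `E_i`, and the
two-sided annihilator of a rank-`ρ` matrix has codimension `≤ 2 d ρ`. -/
theorem finrank_commutant_le_add (E E' : Fin n → Matrix (Fin d) (Fin d) K) :
    finrank K (commutant E') ≤ finrank K (commutant E) + 2 * d * ∑ i, (E i - E' i).rank := by
  classical
  -- the two-sided annihilator of all differences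
  set A : Fin n → Submodule K (Matrix (Fin d) (Fin d) K) := fun i => kerR (E i - E' i) ⊓ kerL (E i - E' i) with hA
  have hAi : ∀ i, d * d ≤ finrank K (A i) + 2 * d * (E i - E' i).rank := by
    intro i
    have h1 := finrank_kerR_add (E i - E' i)
    have h2 := finrank_kerL_add (E i - E' i)
    have h3 := finrank_add_le_finrank_inf_add (kerR (E i - E' i)) (kerL (E i - E' i))
    rw [hA]; dsimp only
    nlinarith
  -- intersect them one by one
  have hAll : ∀ s : Finset (Fin n),
      d * d ≤ finrank K ↥(⨅ i ∈ s, A i) + 2 * d * ∑ i ∈ s, (E i - E' i).rank := by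
    intro s
    induction s using Finset.induction_on with
    | empty =>
        have htop : (⨅ i ∈ (∅ : Finset (Fin n)), A i) = ⊤ := by simp
        rw [htop, finrank_top, finrank_matrix_fin, Finset.sum_empty, mul_zero, add_zero]
    | insert a s ha ih =>
        rw [Finset.iInf_insert, Finset.sum_insert ha]
        have h := finrank_add_le_finrank_inf_add (A a) (⨅ i ∈ s, A i)
        have ha' := hAi a
        nlinarith
  have hsub : commutant E' ⊓ (⨅ i ∈ (Finset.univ : Finset (Fin n)), A i) ≤ commutant E := by
    intro X hX
    rw [Submodule.mem_inf] at hX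
    obtain ⟨hX1, hX2⟩ := hX
    rw [mem_commutant] at hX1 ⊢
    intro i
    have hXi : X ∈ A i := by
      have := (Submodule.mem_iInf _).mp hX2 i
      simpa using this
    rw [hA] at hXi
    obtain ⟨hR, hL⟩ := Submodule.mem_inf.mp hXi
    rw [mem_kerR] at hR; rw [mem_kerL] at hL
    have e1 : X * E i = X * E' i + X * (E i - E' i) := by rw [mul_sub]; abel
    have e2 : E i * X = E' i * X + (E i - E' i) * X := by rw [sub_mul]; abel
    rw [e1, e2, hR, hL, hX1 i]
  have h1 := Submodule.finrank_mono hsub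
  have h2 := finrank_add_le_finrank_inf_add (commutant E') (⨅ i ∈ (Finset.univ : Finset (Fin n)), A i)
  have h3 := hAll Finset.univ
  omega

/-! ## Diagonal genuine tuples have large commutants -/

section Diagonal

variable (c : Fin d → (Fin n → Bool))

/-- The commuting idempotent ("genuine") tuple attached to a colouring `c` of the standard basis by `{0,1}^n`:
`diag_i c = diag(a ↦ [c a i])`. -/
def diagTuple (i : Fin n) : Matrix (Fin d) (Fin d) K := Matrix.diagonal fun a => if c a i then 1 else 0

/-- The diagonal tuple consists of idempotents. -/
theorem diagTuple_idem (i : Fin n) : diagTuple (K := K) c i * diagTuple c i = diagTuple c i := by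
  rw [diagTuple, Matrix.diagonal_mul_diagonal]
  congr 1; ext a; split_ifs <;> simp

/-- The diagonal tuple is commuting. -/
theorem diagTuple_comm (i j : Fin n) : diagTuple (K := K) c i * diagTuple c j = diagTuple c j * diagTuple c i := by
  rw [diagTuple, diagTuple, Matrix.diagonal_mul_diagonal, Matrix.diagonal_mul_diagonal]
  congr 1; ext a; ring

/-- A matrix unit `e_{ab}` with `c a = c b` commutes with the diagonal tuple. -/
theorem single_mem_commutant_diag {a b : Fin d} (hab : c a = c b) :
    Matrix.single a b (1 : K) ∈ commutant (diagTuple (K := K) c) := by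
  rw [mem_commutant]
  intro i
  ext x y
  simp only [diagTuple, Matrix.mul_diagonal, Matrix.diagonal_mul, Matrix.single_apply]
  by_cases h : a = x ∧ b = y
  · obtain ⟨rfl, rfl⟩ := h; simp [hab]
  · simp [h]

/-- The same-colour matrix units are linearly independent members of the commutant, so
`#{(a,b) : c a = c b} ≤ dim Comm(diag c)`. -/
theorem card_sameColour_le_finrank_commutant_diag :
    Fintype.card {p : Fin d × Fin d // c p.1 = c p.2} ≤ finrank K (commutant (diagTuple (K := K) c)) := by
  classical
  set f : {p : Fin d × Fin d // c p.1 = c p.2} → commutant (diagTuple (K := K) c) :=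
    fun p => ⟨Matrix.single p.1.1 p.1.2 (1 : K), single_mem_commutant_diag c p.2⟩ with hf
  have hli : LinearIndependent K f := by
    apply LinearIndependent.of_comp (commutant (diagTuple (K := K) c)).subtype
    have hstd := (Matrix.stdBasis K (Fin d) (Fin d)).linearIndependent
    have h2 : LinearIndependent K (fun p : {p : Fin d × Fin d // c p.1 = c p.2} =>
        Matrix.stdBasis K (Fin d) (Fin d) p.1) := hstd.comp _ Subtype.val_injective
    convert h2 using 1
    funext p
    obtain ⟨⟨a, b⟩, hp⟩ := p
    simp [hf, Matrix.stdBasis_eq_single]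
  exact hli.fintype_card_le_finrank

/-- `d² ≤ 2^n · #{(a,b) : c a = c b}` (Cauchy–Schwarz over the `2^n` colour classes). -/
theorem sq_le_card_mul_card_sameColour :
    d * d ≤ 2 ^ n * Fintype.card {p : Fin d × Fin d // c p.1 = c p.2} := by
  classical
  -- fibre sizes
  set m : (Fin n → Bool) → ℕ := fun σ => (Finset.univ.filter fun a : Fin d => c a = σ).card with hm
  have hsum : ∑ σ, m σ = d := by
    have := Finset.card_eq_sum_card_fiberwise (s := (Finset.univ : Finset (Fin d))) (t := Finset.univ)
      (f := c) (fun a _ => Finset.mem_univ _)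
    simp only [Finset.card_univ, Fintype.card_fin] at this
    rw [this]
  have hpairs : Fintype.card {p : Fin d × Fin d // c p.1 = c p.2} = ∑ σ, m σ ^ 2 := by
    rw [Fintype.card_subtype]
    have : (Finset.univ.filter fun p : Fin d × Fin d => c p.1 = c p.2) =
        Finset.univ.biUnion fun σ => (Finset.univ.filter fun a : Fin d => c a = σ) ×ˢ
          (Finset.univ.filter fun a : Fin d => c a = σ) := by
      ext ⟨a, b⟩
      simp only [Finset.mem_filter, Finset.mem_univ, true_and, Finset.mem_biUnion, Finset.mem_product]
      constructor
      · intro h; exact ⟨c a, rfl, h.symm⟩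
      · rintro ⟨σ, ha, hb⟩; rw [ha, hb]
    rw [this, Finset.card_biUnion]
    · refine Finset.sum_congr rfl fun σ _ => ?_
      rw [Finset.card_product, hm, sq]
    · intro σ _ τ _ hστ
      rw [Function.onFun, Finset.disjoint_left]
      rintro ⟨a, b⟩ h1 h2
      simp only [Finset.mem_product, Finset.mem_filter, Finset.mem_univ, true_and] at h1 h2
      exact hστ (h1.1.symm.trans h2.1)
  rw [hpairs, ← hsum]
  have hcs := sq_sum_le_card_mul_sum_sq (s := (Finset.univ : Finset (Fin n → Bool))) (f := m)
  simp only [Finset.card_univ, Fintype.card_fun, Fintype.card_bool, Fintype.card_fin] at hcs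
  simpa [sq] using hcs

/-- `d² ≤ 2^n · dim Comm(diag c)`: a diagonal genuine tuple on `K^d` has a commutant of dimension `Σ_σ d_σ² ≥ d²/2^n`. -/
theorem sq_le_card_mul_finrank_commutant_diag :
    d * d ≤ 2 ^ n * finrank K (commutant (diagTuple (K := K) c)) :=
  (sq_le_card_mul_card_sameColour c).trans
    (Nat.mul_le_mul_left _ (card_sameColour_le_finrank_commutant_diag c))

end Diagonal

/-! ## The criterion -/

/-- **COMMUTANT CRITERION.**  If every `E_i` is within rank `r` of the diagonal genuine tuple of a colouring `c`, then
`d² ≤ 2^n · (dim Comm(E) + 2 n d r)`.  Contrapositive: a tuple with `2^n (dim Comm(E) + 2 n d r) < d²` is at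
coordinatewise rank distance `> r` from the diagonal genuine tuple of EVERY colouring — a distance lower bound that
uses no certificate formula. -/
theorem commutant_criterion (E : Fin n → Matrix (Fin d) (Fin d) K) (c : Fin d → (Fin n → Bool)) (r : ℕ)
    (hE : ∀ i, (E i - diagTuple c i).rank ≤ r) :
    d * d ≤ 2 ^ n * (finrank K (commutant E) + 2 * n * d * r) := by
  have h1 := sq_le_card_mul_finrank_commutant_diag (K := K) c
  have h2 := finrank_commutant_le_add E (diagTuple (K := K) c)
  have h3 : ∑ i, (E i - diagTuple (K := K) c i).rank ≤ n * r := by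
    have := Finset.sum_le_sum (s := Finset.univ) fun i (_ : i ∈ Finset.univ) => hE i
    simpa [mul_comm] using this
  calc d * d ≤ 2 ^ n * finrank K (commutant (diagTuple (K := K) c)) := h1
    _ ≤ 2 ^ n * (finrank K (commutant E) + 2 * d * ∑ i, (E i - diagTuple (K := K) c i).rank) :=
        Nat.mul_le_mul_left _ h2
    _ ≤ 2 ^ n * (finrank K (commutant E) + 2 * n * d * r) := by
        apply Nat.mul_le_mul_left; apply Nat.add_le_add_left
        calc 2 * d * ∑ i, (E i - diagTuple (K := K) c i).rank ≤ 2 * d * (n * r) := Nat.mul_le_mul_left _ h3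
          _ = 2 * n * d * r := by ring

/-- **Distance form.**  If `2^n · (dim Comm(E) + 2 n d r) < d²` then `E` is at coordinatewise rank distance `> r` from the
diagonal genuine tuple of every colouring `c`. -/
theorem far_from_diagonal_of_small_commutant (E : Fin n → Matrix (Fin d) (Fin d) K) (r : ℕ)
    (h : 2 ^ n * (finrank K (commutant E) + 2 * n * d * r) < d * d) (c : Fin d → (Fin n → Bool)) :
    ∃ i, r < (E i - diagTuple c i).rank := by
  by_contra hcon
  simp only [not_exists, not_lt] at hcon
  exact absurd (commutant_criterion E c r hcon) (not_le.mpr h)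

end Summit.PneNP.PneNP.Theorems.CnfIdealGenLengthRankDefectRepresentationsCommutantCriterion
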